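import Summits.AnomalousDissipation.AnomalousDissipation.Theorems.TaylorGreenLoudGalerkinStates.Negative.LoadBearing
import Literature.Topology.Euclidean.BrowderContinuation

/-!
# Sketch — crux-ideate stmt-AnomalousDissipation-2986 (MirrorVariety.GalerkinSteadyZerothLaw), round 1, ideator 1 (gen 2)

First lemmas of the idea card `dyadic-spine-homotopy-walls`, typed over existing declarations.

* §1 `interp_energy_identity`, `interp_apriori_bound` — every member of an ENERGY-CONSERVING homotopy of
  quadratic steady maps obeys the crux's exact injection identity and the same a-priori radius (PROVED).
* §2 `loud_or_wall_of_connected` — a connected set of (parameter, state) pairs that starts inside an open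
  window either ends inside it or meets its wall (PROVED, pure topology).
* §3 `loud_or_wall` — the Browder form (tree: `Literature.Topology.Euclidean.Browder.exists_isConnected_fixedPoints`)
  of the WALL DICHOTOMY for a homotopy of steady maps with an a-priori radius (PROVED from the tree's Browder theorem).
* §4 `reverse_fatou_nat` (verbatim from SketchIdeator3, attributed), `viscositySelection` (PROVED) and the
  kernel-checked transfer `galerkinSteadyZerothLaw_of_thickViscosities : LoudViscositiesThick f E ε → crux`
  — the ν-AXIS selection step every single-force line can reuse (loud viscosity windows may DRIFT with N).
* §5 `cfSteady`, `DyadicSpineEndpoint` — the solvable endpoint (Cheskidov–Friedlander 2009 viscous dyadic model,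
  truncated) as a typed statement.

The crux is used BY NAME (`Theses.MirrorVariety.GalerkinSteadyZerothLaw`); `crux_iff` records that the landed
vocabulary `IsSteadyState` (Theorems/TaylorGreenLoudGalerkinStates/Negative/LoadBearing.lean) restates it verbatim.
-/

noncomputable section

open scoped InnerProductSpace Topology ENNReal
open MeasureTheory Filter Set Metric
open Literature.Analysis.FunctionSpaces Literature.Analysis.FunctionSpaces.Torus
open Summit.AnomalousDissipation.AnomalousDissipation.Theorems.TaylorGreenLoudGalerkinStates.Negative

namespace Summit.AnomalousDissipation.AnomalousDissipation.Cruxes.GalerkinSteadyZerothLaw.Ideator1G2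

/-- The physical flat unit torus (local notation). -/
local notation "𝕋³" => UnitAddTorus (Fin 3)
/-- Velocity values (local notation). -/
local notation "E³" => EuclideanSpace ℝ (Fin 3)

/-! ## §0 Vocabulary -/

/-- Loud bounded admissible Galerkin steady state at `(ν, N)` for the force `f` with budgets `(E, ε)`:
the crux's bracket (`IsSteadyState`, landed vocabulary) `∧ ∫|U|² ≤ E ∧ ε ≤ ν‖∇U‖²`. -/
def IsLoudBounded (ν : ℝ) (N : ℕ) (f : 𝕋³ → E³) (E ε : ℝ) (U : 𝕋³ → E³) : Prop :=
  IsSteadyState ν N f U ∧ ∫ x, ‖U x‖ ^ 2 ≤ E ∧ ε ≤ ν * gradNormSq U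

/-- The set of LOUD VISCOSITIES at resolution `N`: those `ν` at which `f` has a loud bounded state. -/
def loudViscosities (f : 𝕋³ → E³) (E ε : ℝ) (N : ℕ) : Set ℝ :=
  {ν | ∃ U : 𝕋³ → E³, IsLoudBounded ν N f E ε U}

/-- The crux, verbatim, in this vocabulary (definitional). -/
theorem crux_iff :
    Theses.MirrorVariety.GalerkinSteadyZerothLaw ↔
      ∃ f : 𝕋³ → E³, IsSmooth f ∧ IsDivFree f ∧ HasZeroMean f ∧ ∃ (ν : ℕ → ℝ) (E ε : ℝ),
        (∀ j, 0 < ν j) ∧ Tendsto ν atTop (𝓝 0) ∧ 0 < ε ∧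
        ∀ j, ∃ᶠ N in atTop, ∃ U : 𝕋³ → E³, IsLoudBounded (ν j) N f E ε U :=
  Iff.rfl

/-! ## §1 Energy-conserving homotopies of quadratic steady maps

Abstract finite-dimensional setting: `V` a real inner product space (the Galerkin phase space), `S` the viscous
operator (`νA`, coercive), `B₀`, `B₁` two nonlinearities with the ENERGY CANCELLATION `⟪Bᵢ c c, c⟫ = 0`
(`B₁` = the Galerkin Navier–Stokes map `P_N B`, `B₀` = the embedded dyadic spine), `g` the force. The
interpolated steady map is `F t c = S c + (1 - t) • B₀ c c + t • B₁ c c - g`. -/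

section Homotopy

variable {V : Type*} [NormedAddCommGroup V] [InnerProductSpace ℝ V]

/-- **Injection identity along the homotopy** (the crux's `energy_identity`, uniformly in `t`): at every zero
of the interpolated steady map, `⟪S c, c⟫ = ⟪g, c⟫` — loudness is the linear functional `⟪g, ·⟫` for EVERY
member of an energy-conserving family, so the loud wall `{⟪g,c⟫ = ε}` is the same hyperplane for all `t`.
[folklore] -/
theorem interp_energy_identity (S : V → V) (B₀ B₁ : V → V → V) (g : V)
    (hB₀ : ∀ c, ⟪B₀ c c, c⟫_ℝ = 0) (hB₁ : ∀ c, ⟪B₁ c c, c⟫_ℝ = 0) {t : ℝ} {c : V}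
    (hz : S c + (1 - t) • B₀ c c + t • B₁ c c = g) :
    ⟪S c, c⟫_ℝ = ⟪g, c⟫_ℝ := by
  have h := congrArg (fun v => ⟪v, c⟫_ℝ) hz
  simp only [inner_add_left, inner_smul_left, hB₀, hB₁, mul_zero, add_zero] at h
  simpa using h

/-- **A-priori radius along the homotopy**: if `S` is `m`-coercive (`m‖c‖² ≤ ⟪Sc,c⟫`, `m > 0`: for `νA` on
mean-zero fields `m = 4π²ν`), every zero of every member satisfies `‖c‖ ≤ ‖g‖/m` — zeros cannot escape to
infinity during the deformation, so Browder continuation / degree apply on one fixed ball. [folklore] -/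
theorem interp_apriori_bound (S : V → V) (B₀ B₁ : V → V → V) (g : V)
    (hB₀ : ∀ c, ⟪B₀ c c, c⟫_ℝ = 0) (hB₁ : ∀ c, ⟪B₁ c c, c⟫_ℝ = 0) {m : ℝ} (hm : 0 < m)
    (hS : ∀ c, m * ‖c‖ ^ 2 ≤ ⟪S c, c⟫_ℝ) {t : ℝ} {c : V}
    (hz : S c + (1 - t) • B₀ c c + t • B₁ c c = g) :
    ‖c‖ ≤ ‖g‖ / m := by
  have hid := interp_energy_identity S B₀ B₁ g hB₀ hB₁ hz
  have h1 : m * ‖c‖ ^ 2 ≤ ‖g‖ * ‖c‖ := by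
    calc m * ‖c‖ ^ 2 ≤ ⟪S c, c⟫_ℝ := hS c
      _ = ⟪g, c⟫_ℝ := hid
      _ ≤ ‖g‖ * ‖c‖ := real_inner_le_norm g c
  by_cases hc : c = 0
  · simp [hc, div_nonneg (norm_nonneg g) hm.le]
  · have hcpos : 0 < ‖c‖ := norm_pos_iff.mpr hc
    rw [le_div_iff₀ hm]
    have h2 : m * ‖c‖ * ‖c‖ ≤ ‖g‖ * ‖c‖ := by nlinarith
    have h3 := le_of_mul_le_mul_right h2 hcpos
    linarith [h3]

/-- **Loudness is bounded along the homotopy** by `‖g‖ · ‖c‖` (the general-force ceiling of the standing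
Disproof, now for every `t`): `⟪g, c⟫ ≤ ‖g‖‖c‖ ≤ ‖g‖²/m`. [folklore] -/
theorem interp_loudness_le (S : V → V) (B₀ B₁ : V → V → V) (g : V)
    (hB₀ : ∀ c, ⟪B₀ c c, c⟫_ℝ = 0) (hB₁ : ∀ c, ⟪B₁ c c, c⟫_ℝ = 0) {m : ℝ} (hm : 0 < m)
    (hS : ∀ c, m * ‖c‖ ^ 2 ≤ ⟪S c, c⟫_ℝ) {t : ℝ} {c : V}
    (hz : S c + (1 - t) • B₀ c c + t • B₁ c c = g) :
    ⟪g, c⟫_ℝ ≤ ‖g‖ ^ 2 / m := by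
  have hb := interp_apriori_bound S B₀ B₁ g hB₀ hB₁ hm hS hz
  calc ⟪g, c⟫_ℝ ≤ ‖g‖ * ‖c‖ := real_inner_le_norm g c
    _ ≤ ‖g‖ * (‖g‖ / m) := by gcongr
    _ = ‖g‖ ^ 2 / m := by ring

end Homotopy

/-! ## §2 The wall dichotomy for a continuum (pure topology) -/

section Walls

variable {V : Type*} [TopologicalSpace V]

/-- **Loud-or-wall, continuum form.** Let `K ⊆ ℝ × V` be preconnected (the Browder continuum of
(parameter, steady state) pairs), let `W ⊆ V` be open (the loud bounded window), and suppose every point of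
`K` over the parameter `0` lies in `W` and `K` has a point over `0`. Then EITHER every point of `K` (in
particular every point over the parameter `1`) lies in `W`, OR `K` meets the wall `frontier W`. [folklore] -/
theorem subset_or_wall_of_preconnected {K : Set (ℝ × V)} (hK : IsPreconnected K) {W : Set V}
    (hW : IsOpen W) (h0 : ∃ p ∈ K, p.1 = 0) (hK0 : ∀ p ∈ K, p.1 = 0 → p.2 ∈ W) :
    K ⊆ univ ×ˢ W ∨ ∃ p ∈ K, p.2 ∈ frontier W := by
  classical
  by_cases hsub : K ⊆ univ ×ˢ W
  · exact Or.inl hsub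
  · right
    have hU : IsOpen ((univ : Set ℝ) ×ˢ W) := isOpen_univ.prod hW
    have hne : (K ∩ (univ ×ˢ W)).Nonempty := by
      obtain ⟨p, hp, hp0⟩ := h0
      exact ⟨p, hp, mem_univ _, hK0 p hp hp0⟩
    -- if the closure condition held, `K ⊆ univ ×ˢ W`, contradiction; so some point of K lies on the frontier
    by_contra hcon
    push Not at hcon
    apply hsub
    refine hK.subset_of_closure_inter_subset hU hne ?_
    intro p hp
    obtain ⟨hpcl, hpK⟩ := hp
    by_contra hpW
    have hfr : p ∈ frontier ((univ : Set ℝ) ×ˢ W) := by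
      rw [hU.frontier_eq]
      exact ⟨hpcl, hpW⟩
    rw [frontier_univ_prod_eq] at hfr
    exact hcon p hpK hfr.2

/-- **Loud-or-wall, endpoint form.** Under the hypotheses of `subset_or_wall_of_preconnected`, if `K` also
has a point over the parameter `1`, then either some point of `K` over `1` lies in the window, or `K` meets
the wall. [folklore] -/
theorem loud_or_wall_of_preconnected {K : Set (ℝ × V)} (hK : IsPreconnected K) {W : Set V}
    (hW : IsOpen W) (h0 : ∃ p ∈ K, p.1 = 0) (hK0 : ∀ p ∈ K, p.1 = 0 → p.2 ∈ W)
    (h1 : ∃ p ∈ K, p.1 = 1) :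
    (∃ p ∈ K, p.1 = 1 ∧ p.2 ∈ W) ∨ ∃ p ∈ K, p.2 ∈ frontier W := by
  rcases subset_or_wall_of_preconnected hK hW h0 hK0 with hsub | hwall
  · left
    obtain ⟨p, hp, hp1⟩ := h1
    exact ⟨p, hp, hp1, (hsub hp).2⟩
  · exact Or.inr hwall

end Walls

/-! ## §3 The Browder form of the wall dichotomy (proved from the tree's Browder theorem)

`Φ t` is the fixed-point reformulation `c ↦ (νA)⁻¹(ĝ − B_t(c,c))` composed with the radial retraction onto the
a-priori ball `‖c‖ ≤ R` (`interp_apriori_bound`; the retraction adds NO fixed point: a fixed point `c = Φ t (r c)`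
with `‖c‖ > R` would be a steady state of viscosity `sν`, `s > 1`, of norm `R > ‖g‖/(sνλ₁)`), so `Φ` maps a box
into itself and the tree's Browder theorem gives a continuum of fixed points from `t = 0` to `t = 1`;
§2 then yields the dichotomy. Size M (box bookkeeping around `exists_isConnected_fixedPoints_inter_faces`). -/

/-- **Loud-or-wall (Browder form).** A continuous one-parameter family of continuous self-maps of a box of
`ι → ℝ` (parameter adjoined as the coordinate `i₀`, slices preserved) whose fixed points over the face
`x i₀ = a i₀` all lie in an open window `W` (and exist) has, over the opposite face `x i₀ = b i₀`, a fixed point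
in `W` — OR some fixed point at an intermediate parameter lies on the wall `frontier W`.
[cite: SolanSolan2023, Theorem 1.1] -/
theorem loud_or_wall {ι : Type*} [Fintype ι] [DecidableEq ι] {a b : ι → ℝ} (hab : a ≤ b) (i₀ : ι)
    {f : (ι → ℝ) → (ι → ℝ)} (hf : Continuous f) (hmaps : ∀ x, a ≤ x → x ≤ b → a ≤ f x ∧ f x ≤ b)
    (hpar : ∀ x, f x i₀ = x i₀) {W : Set (ι → ℝ)} (hW : IsOpen W)
    (hstart : ∀ x, a ≤ x → x ≤ b → f x = x → x i₀ = a i₀ → x ∈ W) :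
    (∃ x, a ≤ x ∧ x ≤ b ∧ f x = x ∧ x i₀ = b i₀ ∧ x ∈ W) ∨
      ∃ x, a ≤ x ∧ x ≤ b ∧ f x = x ∧ x ∈ frontier W := by
  classical
  obtain ⟨C, hCsub, hCconn, ⟨x, hxC, hxa⟩, ⟨y, hyC, hyb⟩⟩ :=
    Literature.Topology.Euclidean.Browder.exists_isConnected_fixedPoints_inter_faces hab i₀ hf hmaps hpar
  have hxW : x ∈ W := hstart x (hCsub hxC).1 (hCsub hxC).2.1 (hCsub hxC).2.2 hxa
  by_cases hCW : C ⊆ W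
  · exact Or.inl ⟨y, (hCsub hyC).1, (hCsub hyC).2.1, (hCsub hyC).2.2, hyb, hCW hyC⟩
  · right
    by_contra hcon
    push Not at hcon
    apply hCW
    refine hCconn.isPreconnected.subset_of_closure_inter_subset hW ⟨x, hxC, hxW⟩ ?_
    rintro p ⟨hpcl, hpC⟩
    by_contra hpW
    have hfr : p ∈ frontier W := by
      rw [hW.frontier_eq]
      exact ⟨hpcl, hpW⟩
    exact hcon p (hCsub hpC).1 (hCsub hpC).2.1 (hCsub hpC).2.2 hfr

/-! ## §4 Selection on the VISCOSITY axis (reverse Fatou) and the transfer to the crux -/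

/-- Reverse Fatou along `ℕ` inside a set of finite measure: if `p ≤ μ (A N)` for infinitely many `N`, then
`p ≤ μ (limsup A)` (written as `⋂ n, ⋃ N ≥ n, A N`). Verbatim from `SketchIdeator3.reverse_fatou_nat`
(crux-ideate r1 k3, this crux), reproduced so that this file is self-contained. [folklore] -/
theorem reverse_fatou_nat {α : Type*} [MeasurableSpace α] {μ : Measure α} {A : ℕ → Set α} {S : Set α}
    (hS : μ S ≠ ∞) (hA : ∀ N, MeasurableSet (A N)) (hAS : ∀ N, A N ⊆ S) {p : ℝ≥0∞}
    (hp : ∃ᶠ N in atTop, p ≤ μ (A N)) :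
    p ≤ μ (⋂ n, ⋃ N, ⋃ (_ : n ≤ N), A N) := by
  have hDmeas : ∀ n, MeasurableSet (⋃ N, ⋃ (_ : n ≤ N), A N) := fun n =>
    MeasurableSet.iUnion fun N => MeasurableSet.iUnion fun _ => hA N
  have hDS : ∀ n, (⋃ N, ⋃ (_ : n ≤ N), A N) ⊆ S := fun n =>
    Set.iUnion_subset fun N => Set.iUnion_subset fun _ => hAS N
  have hanti : ∀ n n', n ≤ n' → (⋃ N, ⋃ (_ : n' ≤ N), A N) ⊆ ⋃ N, ⋃ (_ : n ≤ N), A N := by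
    intro n n' hnn' a ha
    simp only [Set.mem_iUnion] at ha ⊢
    obtain ⟨N, hN, haN⟩ := ha
    exact ⟨N, hnn'.trans hN, haN⟩
  have hanti' : Antitone fun n => ⋃ N, ⋃ (_ : n ≤ N), A N := fun n n' hnn' => hanti n n' hnn'
  have hfin : ∃ n, μ (⋃ N, ⋃ (_ : n ≤ N), A N) ≠ ∞ :=
    ⟨0, ((measure_mono (hDS 0)).trans_lt hS.lt_top).ne⟩
  have key : μ (⋂ n, ⋃ N, ⋃ (_ : n ≤ N), A N) = ⨅ n, μ (⋃ N, ⋃ (_ : n ≤ N), A N) :=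
    hanti'.measure_iInter (fun n => (hDmeas n).nullMeasurableSet) hfin
  rw [key]
  refine le_iInf fun n => ?_
  obtain ⟨N, hN, hpN⟩ := Filter.frequently_atTop.mp hp n
  exact hpN.trans (measure_mono fun a ha => Set.mem_iUnion.mpr ⟨N, Set.mem_iUnion.mpr ⟨hN, ha⟩⟩)

/-- **Viscosity selection** (first lemma of the ν-axis step; Lebesgue measure on `ℝ`, provable now and proved).
If, for every `δ > 0`, measurable sets `I N ⊆ (0, δ)` of "good viscosities" have measure `≥ p δ > 0` for
infinitely many resolutions `N` — the good windows may DRIFT with `N` — then there is ONE sequence `ν_j → 0⁺`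
each of whose members is good at infinitely many resolutions. [folklore] -/
theorem viscositySelection (I : ℕ → Set ℝ) (hI : ∀ N, MeasurableSet (I N))
    (hthick : ∀ δ : ℝ, 0 < δ → ∃ p : ℝ≥0∞, 0 < p ∧ ∃ᶠ N in atTop, p ≤ volume (I N ∩ Ioo 0 δ)) :
    ∃ ν : ℕ → ℝ, (∀ j, 0 < ν j) ∧ Tendsto ν atTop (𝓝 0) ∧ ∀ j, ∃ᶠ N in atTop, ν j ∈ I N := by
  -- at each scale δ, one viscosity in (0, δ) that is good for infinitely many N
  have step : ∀ δ : ℝ, 0 < δ → ∃ ν ∈ Ioo (0 : ℝ) δ, ∃ᶠ N in atTop, ν ∈ I N := by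
    intro δ hδ
    obtain ⟨p, hp, hfreq⟩ := hthick δ hδ
    have hS : volume (Ioo (0 : ℝ) δ) ≠ ∞ := by simp [Real.volume_Ioo]
    have hmeas : ∀ N, MeasurableSet (I N ∩ Ioo 0 δ) := fun N => (hI N).inter measurableSet_Ioo
    have hsub : ∀ N, I N ∩ Ioo 0 δ ⊆ Ioo 0 δ := fun N => inter_subset_right
    have hlim := reverse_fatou_nat hS hmeas hsub hfreq
    obtain ⟨ν, hν⟩ := nonempty_of_measure_ne_zero (hp.trans_le hlim).ne'
    have hν0 := Set.mem_iInter.mp hν 0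
    simp only [Set.mem_iUnion] at hν0
    obtain ⟨N₀, -, hN₀⟩ := hν0
    refine ⟨ν, hN₀.2, Filter.frequently_atTop.mpr fun n => ?_⟩
    have hνn := Set.mem_iInter.mp hν n
    simp only [Set.mem_iUnion] at hνn
    obtain ⟨N, hN, hνN⟩ := hνn
    exact ⟨N, hN, hνN.1⟩
  choose ν hν hνgood using fun j : ℕ => step (1 / ((j : ℝ) + 1)) (by positivity)
  refine ⟨ν, fun j => (hν j).1, ?_, hνgood⟩
  -- squeeze: 0 < ν j < 1/(j+1) → 0
  have hupper : Tendsto (fun j : ℕ => 1 / ((j : ℝ) + 1)) atTop (𝓝 0) :=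
    tendsto_one_div_add_atTop_nhds_zero_nat
  refine tendsto_of_tendsto_of_tendsto_of_le_of_le tendsto_const_nhds hupper
    (fun j => (hν j).1.le) (fun j => (hν j).2.le)

/-- **C⁺_ν — thick loud viscosities.** For ONE fixed admissible force `f` and budgets `(E, ε)`: at every
viscosity scale `δ`, for infinitely many resolutions `N`, the loud viscosities in `(0, δ)` contain a measurable
set of Lebesgue measure at least `p δ > 0`. The good windows are allowed to move with `N` (log-periodic
modulation, isolas born and dying, folds accumulating); only their total length per scale is pinned. -/
def LoudViscositiesThick (f : 𝕋³ → E³) (E ε : ℝ) : Prop :=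
  ∀ δ : ℝ, 0 < δ → ∃ p : ℝ≥0∞, 0 < p ∧ ∃ᶠ N in atTop,
    ∃ A : Set ℝ, MeasurableSet A ∧ A ⊆ loudViscosities f E ε N ∩ Ioo 0 δ ∧ p ≤ volume A

/-- **The ν-axis transfer, kernel-checked:** thick loud viscosities for one admissible force ⇒ the crux
(with that force, those budgets, and the selected sequence `ν_j → 0⁺`; the crux's `∀ j, ∃ᶠ N` is matched
exactly). Usable by EVERY single-force line (froth, sink lattice, frozen-top base points, the dyadic-spine
homotopy of this card): none of them needs loud states at prescribed viscosities, only on thick sets. -/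
theorem galerkinSteadyZerothLaw_of_thickViscosities {f : 𝕋³ → E³} (hf : IsSmooth f) (hdf : IsDivFree f)
    (hzf : HasZeroMean f) {E ε : ℝ} (hε : 0 < ε) (h : LoudViscositiesThick f E ε) :
    Theses.MirrorVariety.GalerkinSteadyZerothLaw := by
  classical
  -- a measurable thick inner approximation of the good set, chosen at each (scale index m, resolution N)
  have key : ∀ (m N : ℕ), ∃ A : Set ℝ, MeasurableSet A ∧ A ⊆ loudViscosities f E ε N ∧
      ((∃ A' : Set ℝ, MeasurableSet A' ∧ A' ⊆ loudViscosities f E ε N ∩ Ioo 0 (1 / ((m : ℝ) + 1)) ∧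
        Classical.choose (h (1 / ((m : ℝ) + 1)) (by positivity)) ≤ volume A') →
        Classical.choose (h (1 / ((m : ℝ) + 1)) (by positivity)) ≤ volume (A ∩ Ioo 0 (1 / ((m : ℝ) + 1)))) := by
    intro m N
    by_cases hex : ∃ A' : Set ℝ, MeasurableSet A' ∧ A' ⊆ loudViscosities f E ε N ∩ Ioo 0 (1 / ((m : ℝ) + 1)) ∧
        Classical.choose (h (1 / ((m : ℝ) + 1)) (by positivity)) ≤ volume A'
    · obtain ⟨A', hm', hsub, hvol⟩ := hex
      refine ⟨A', hm', fun x hx => (hsub hx).1, fun _ => hvol.trans (measure_mono fun x hx => ⟨hx, (hsub hx).2⟩)⟩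
    · exact ⟨∅, MeasurableSet.empty, empty_subset _, fun h' => absurd h' hex⟩
  choose A hAmeas hAgood hAthick using key
  -- the union over scale indices of the chosen sets at resolution N is measurable and good
  let I : ℕ → Set ℝ := fun N => ⋃ m, A m N
  have hImeas : ∀ N, MeasurableSet (I N) := fun N => MeasurableSet.iUnion fun m => hAmeas m N
  have hIgood : ∀ N, I N ⊆ loudViscosities f E ε N := fun N => iUnion_subset fun m => hAgood m N
  have hIthick : ∀ δ : ℝ, 0 < δ → ∃ p : ℝ≥0∞, 0 < p ∧ ∃ᶠ N in atTop, p ≤ volume (I N ∩ Ioo 0 δ) := by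
    intro δ hδ
    -- pick a scale index m with 1/(m+1) ≤ δ
    obtain ⟨m, hm⟩ := exists_nat_one_div_lt hδ
    set δm : ℝ := 1 / ((m : ℝ) + 1) with hδm
    have hδmpos : 0 < δm := by positivity
    obtain ⟨hp, hfreq⟩ := Classical.choose_spec (h δm hδmpos)
    refine ⟨Classical.choose (h δm hδmpos), hp, hfreq.mono fun N hN => ?_⟩
    have h1 := hAthick m N hN
    refine h1.trans (measure_mono fun x hx => ⟨mem_iUnion.mpr ⟨m, hx.1⟩, hx.2.1, hx.2.2.trans hm⟩)
  obtain ⟨ν, hνpos, hν0, hνI⟩ := viscositySelection I hImeas hIthick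
  refine ⟨f, hf, hdf, hzf, ν, E, ε, hνpos, hν0, hε, fun j => ?_⟩
  exact (hνI j).mono fun N hN => hIgood N hN

/-! ## §5 The solvable endpoint: the truncated viscous dyadic model (Cheskidov–Friedlander 2009)

`ȧ_n + ν 2^{2n} a_n − 2^{c(n−1)} a_{n−1}² + 2^{cn} a_n a_{n+1} = f₀ δ_{n0}` (Cheskidov–Friedlander,
Physica D 238 (2009), doi:10.1016/j.physd.2009.01.011 = arXiv:0810.3718, (1.2); unique fixed point = global
attractor for `c ∈ (3/2, 5/2]`, Thm 3.4; its dissipation tends to the inviscid anomalous rate `ε_d > 0`, Thm 4.2).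
Embedded in the Galerkin space on the Stokes eigenfields `φ_n(x) = f_TG(2ⁿx)/‖f_TG‖` (shells `|k|² = 3·4ⁿ`,
`Aφ_n = 12π²·4ⁿ φ_n`, so `νA` restricted to the spine IS the dyadic viscous term with `ν' = 12π²ν`), the dyadic
nonlinearity is an energy-conserving bilinear map of the Galerkin space acting trivially off the spine. -/

/-- Steady system of the viscous dyadic model truncated at level `J` (`a (J+1)` plays no role: the last
equation reads `ν 4^J a_J − 2^{c(J−1)} a_{J−1}² = 0`), force `f₀` on the node `0`. -/
def cfSteady (c ν f₀ : ℝ) (J : ℕ) (a : ℕ → ℝ) : Prop :=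
  (∀ n, J < n → a n = 0) ∧
    ∀ n ≤ J, ν * (4 : ℝ) ^ n * a n - (if n = 0 then 0 else (2 : ℝ) ^ (c * ((n : ℝ) - 1)) * a (n - 1) ^ 2) +
      (2 : ℝ) ^ (c * (n : ℝ)) * a n * a (n + 1) = if n = 0 then f₀ else 0

/-- **Stub statement (the endpoint).** For `c = 2`, `f₀ = 1`: there are budgets `E₀, ε₀ > 0` such that for
every `ν ∈ (0, 1]` and every truncation level `J ≥ J₀(ν)` the truncated steady dyadic system has EXACTLY ONE
solution, and it is loud and bounded uniformly: `Σ a_n² ≤ E₀`, `f₀ a 0 ≥ ε₀` (injection = dissipation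
`ν Σ 4ⁿ a_n²`). Galerkin-level version of Cheskidov–Friedlander 2009 Thm 3.4 + Thm 4.2 (monotonicity à la
Heywood, Thm 2.2); size M–L. -/
def DyadicSpineEndpoint : Prop :=
  ∃ E₀ ε₀ : ℝ, 0 < ε₀ ∧ ∀ ν : ℝ, 0 < ν → ν ≤ 1 → ∃ J₀ : ℕ, ∀ J ≥ J₀,
    (∃! a : ℕ → ℝ, cfSteady 2 ν 1 J a) ∧
      ∀ a : ℕ → ℝ, cfSteady 2 ν 1 J a → (∑ n ∈ Finset.range (J + 1), a n ^ 2) ≤ E₀ ∧ ε₀ ≤ a 0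

end Summit.AnomalousDissipation.AnomalousDissipation.Cruxes.GalerkinSteadyZerothLaw.Ideator1G2
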